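import Mathlib
import Summits.Ventures.PercRepro2.Defs
import Summits.Ventures.PercRepro2.Independence
import Summits.Ventures.PercRepro2.Harris
import Summits.Ventures.PercRepro2.ZCTwoEdge

/-!
# (ZC), two root edges, with an independent root-side remainder (blind cell PercRepro2, mine-a g22;
MINE-A.md §69.7)

`zc_two_edge` (ZCTwoEdge.lean) extended by a fifth increasing event `X₀ ⊆ X₁ ∩ X₂`, the value of
`U` when BOTH root edges are closed: the root may carry further edges into parts of `G − a₁` that
avoid `a₃` and `o` (their hits are independent of `A' = {a₃ ↔ o off a₁}`, which is the only extra
hypothesis used: `P(X₀) · P(A'ᶜ) ≤ P(X₀ ∩ A'ᶜ)`).  The slack loses exactly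
`(1−p₁)²(1−p₂)² p₂ π (1−g) P(X₀)` and the explicit bound becomes
`(1−p₁)²(1−p₂)² p₂ π · (P(X₁₂ ∩ A'ᶜ) − (1−g) P(X₀)) ≥ 0`.  Same proof: two-edge pinning, one Harris
inequality, the coefficient identity.  One seat.
-/

namespace Summit.Ventures.PercRepro2

section TwoEdgeTheorem

variable {E : Type*} [Fintype E] [DecidableEq E] {R : Type*} [CommRing R] [LinearOrder R]
  [IsStrictOrderedRing R]


/-- The algebraic core of Theorem A: with `p₁ = p f₁`, `p₂ = p f₂`, `g = P(A')`, `a = P(X₁₂ ∩ A')`,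
`z = P(X₁₂ ∩ A'ᶜ)`, `b = P(X₁ ∩ A'ᶜ)`, `d = P(X₂ ∩ A'ᶜ)`, the (ZC) expression minus the explicit
bound equals `(1−p₁)(1−p₂)·{π₂(1−p₂π)[(1−g)a − gz] + c_β(z − b) + c_δ(z − d)}`, a sum of products
of nonnegative factors (`(1−g)a ≥ gz` is the Harris inequality, `b, d ≤ z` the monotonicity). -/
lemma zc_two_edge_alg' (p₁ p₂ g a z b d x₀ : R) (hp1 : 0 ≤ p₁) (hp1' : p₁ ≤ 1) (hp2 : 0 ≤ p₂)
    (hp2' : p₂ ≤ 1) (hg0 : 0 ≤ g) (hg1 : g ≤ 1) (hHar : (a + z) * g ≤ a) (hzb : b ≤ z)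
    (hzd : d ≤ z) :
    (1 - p₁) * (1 - p₂) * (1 - g) *
      (p₁ * p₂ * (a + z) + p₁ * (1 - p₂) * a + (1 - p₁) * p₂ * a
        - (p₁ * p₂ * (a + z) + p₁ * (1 - p₂) * (a + b) + (1 - p₁) * p₂ * (a + d)
            + (1 - p₁) * (1 - p₂) * x₀)
          * (p₁ * p₂ + p₁ * (1 - p₂) * g + (1 - p₁) * p₂ * g))
      - (1 - p₁) * (1 - p₂) * g *
        (p₁ * (1 - p₂) * b
          - (p₁ * p₂ * (a + z) + p₁ * (1 - p₂) * (a + b) + (1 - p₁) * p₂ * (a + d)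
              + (1 - p₁) * (1 - p₂) * x₀)
            * (p₁ * (1 - p₂) * (1 - g)))
      ≥ (1 - p₁) ^ 2 * (1 - p₂) ^ 2 * p₂ * (g + p₁ - g * p₁) * (z - (1 - g) * x₀) := by
  have h1p : 0 ≤ 1 - p₁ := sub_nonneg.2 hp1'
  have h1q : 0 ≤ 1 - p₂ := sub_nonneg.2 hp2'
  have h1g : 0 ≤ 1 - g := sub_nonneg.2 hg1
  have hπ0 : 0 ≤ g + p₁ - g * p₁ := by
    have := mul_nonneg hg0 h1p; linarith
  have hπ : g + p₁ - g * p₁ ≤ 1 := by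
    have := mul_nonneg h1g h1p; linarith
  have hqπ : 0 ≤ 1 - p₂ * (g + p₁ - g * p₁) := by
    have := mul_le_mul_of_nonneg_right hp2' hπ0; linarith
  have hπ₂ : 0 ≤ p₁ + p₂ - p₁ * p₂ := by
    have := mul_nonneg hp2 h1p; linarith
  have hHar' : 0 ≤ (1 - g) * a - g * z := by linarith
  have hcβ : 0 ≤ p₁ * (1 - p₂) * (g + (1 - g) * p₂ * (g + p₁ - g * p₁)) :=
    mul_nonneg (mul_nonneg hp1 h1q)
      (add_nonneg hg0 (mul_nonneg (mul_nonneg h1g hp2) hπ0))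
  have hcδ : 0 ≤ (1 - g) * (1 - p₁) * p₂ ^ 2 * (g + p₁ - g * p₁) :=
    mul_nonneg (mul_nonneg (mul_nonneg h1g h1p) (sq_nonneg _)) hπ0
  have hnn : 0 ≤ (1 - p₁) * (1 - p₂) *
        ((p₁ + p₂ - p₁ * p₂) * (1 - p₂ * (g + p₁ - g * p₁)) * ((1 - g) * a - g * z)
          + p₁ * (1 - p₂) * (g + (1 - g) * p₂ * (g + p₁ - g * p₁)) * (z - b)
          + (1 - g) * (1 - p₁) * p₂ ^ 2 * (g + p₁ - g * p₁) * (z - d)) :=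
    mul_nonneg (mul_nonneg h1p h1q)
      (add_nonneg (add_nonneg (mul_nonneg (mul_nonneg hπ₂ hqπ) hHar')
        (mul_nonneg hcβ (sub_nonneg.2 hzb))) (mul_nonneg hcδ (sub_nonneg.2 hzd)))
  have key : (1 - p₁) * (1 - p₂) * (1 - g) *
      (p₁ * p₂ * (a + z) + p₁ * (1 - p₂) * a + (1 - p₁) * p₂ * a
        - (p₁ * p₂ * (a + z) + p₁ * (1 - p₂) * (a + b) + (1 - p₁) * p₂ * (a + d)
            + (1 - p₁) * (1 - p₂) * x₀)
          * (p₁ * p₂ + p₁ * (1 - p₂) * g + (1 - p₁) * p₂ * g))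
      - (1 - p₁) * (1 - p₂) * g *
        (p₁ * (1 - p₂) * b
          - (p₁ * p₂ * (a + z) + p₁ * (1 - p₂) * (a + b) + (1 - p₁) * p₂ * (a + d)
              + (1 - p₁) * (1 - p₂) * x₀)
            * (p₁ * (1 - p₂) * (1 - g)))
      - (1 - p₁) ^ 2 * (1 - p₂) ^ 2 * p₂ * (g + p₁ - g * p₁) * (z - (1 - g) * x₀)
      = (1 - p₁) * (1 - p₂) *
        ((p₁ + p₂ - p₁ * p₂) * (1 - p₂ * (g + p₁ - g * p₁)) * ((1 - g) * a - g * z)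
          + p₁ * (1 - p₂) * (g + (1 - g) * p₂ * (g + p₁ - g * p₁)) * (z - b)
          + (1 - g) * (1 - p₁) * p₂ ^ 2 * (g + p₁ - g * p₁) * (z - d)) := by ring
  linarith [key, hnn]

/-- **Theorem A with a root-side remainder (MINE-A.md §69.7)** — `zc_two_edge` with the value `X₀`
of `U` when both root edges are closed (`X₀ ⊆ X₁ ∩ X₂`); the root is joined to `a₃`, `o` by the two edges `f₁ = a₁a₃` (weight `p f₁`) and `f₂ = a₁o` (weight `p f₂`), for
every cluster up-set: with `e`, `L`, `U`, `γ` as above and `B = eᶜ ∩ Lᶜ ∩ γ`, `D = eᶜ ∩ Lᶜ ∩ γᶜ`,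
  `P(D) · (P(U ∩ e ∩ L) − P(U) P(e ∩ L)) − P(B) · (P(U ∩ e ∩ Lᶜ) − P(U) P(e ∩ Lᶜ))`
  `≥ (1 − p f₁)² (1 − p f₂)² · p f₂ · (g + p f₁ − g · p f₁) · P(X₁₂ ∩ A'ᶜ) ≥ 0`, `g = P(A')`.
Inputs: `A'`, `X₁`, `X₂`, `X₁₂` ignore `f₁`, `f₂` (membership is invariant under forcing them); `A'`, `X₁₂` increasing (one Harris inequality);
`X₁ ∩ A' = X₁₂ ∩ A'`, `X₂ ∩ A' = X₁₂ ∩ A'` (on `a₃ ↔ o` the three glued clusters coincide);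
`X₁ ⊆ X₁₂`, `X₂ ⊆ X₁₂` (monotonicity of the up-set). -/
theorem zc_two_edge' {p : E → R} (hp : IsProbVec p) {f₁ f₂ : E} (hf : f₁ ≠ f₂)
    {A' X₁ X₂ X₁₂ X₀ : Set (Config E)}
    (hA' : ∀ (ω : Config E) (b₁ b₂ : Bool),
      Function.update (Function.update ω f₁ b₁) f₂ b₂ ∈ A' ↔ ω ∈ A')
    (hX₁ : ∀ (ω : Config E) (b₁ b₂ : Bool),
      Function.update (Function.update ω f₁ b₁) f₂ b₂ ∈ X₁ ↔ ω ∈ X₁)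
    (hX₂ : ∀ (ω : Config E) (b₁ b₂ : Bool),
      Function.update (Function.update ω f₁ b₁) f₂ b₂ ∈ X₂ ↔ ω ∈ X₂)
    (hX₁₂ : ∀ (ω : Config E) (b₁ b₂ : Bool),
      Function.update (Function.update ω f₁ b₁) f₂ b₂ ∈ X₁₂ ↔ ω ∈ X₁₂)
    (hX₀ : ∀ (ω : Config E) (b₁ b₂ : Bool),
      Function.update (Function.update ω f₁ b₁) f₂ b₂ ∈ X₀ ↔ ω ∈ X₀)
    (hA'up : IsUpperSet A') (hX₁₂up : IsUpperSet X₁₂)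
    (h1 : X₁ ∩ A' = X₁₂ ∩ A') (h2 : X₂ ∩ A' = X₁₂ ∩ A') (h1s : X₁ ⊆ X₁₂) (h2s : X₂ ⊆ X₁₂) :
    let e := openEdge f₁ ∪ (openEdge f₂ ∩ A')
    let L := openEdge f₂ ∪ (openEdge f₁ ∩ A')
    let U := (openEdge f₁ ∩ closedEdge f₂ ∩ X₁) ∪ (closedEdge f₁ ∩ openEdge f₂ ∩ X₂)
      ∪ (openEdge f₁ ∩ openEdge f₂ ∩ X₁₂) ∪ (closedEdge f₁ ∩ closedEdge f₂ ∩ X₀)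
    let γ := A' ∪ (openEdge f₁ ∩ openEdge f₂)
    prob p (eᶜ ∩ Lᶜ ∩ γᶜ) * (prob p (U ∩ (e ∩ L)) - prob p U * prob p (e ∩ L))
      - prob p (eᶜ ∩ Lᶜ ∩ γ) * (prob p (U ∩ (e ∩ Lᶜ)) - prob p U * prob p (e ∩ Lᶜ))
      ≥ (1 - p f₁) ^ 2 * (1 - p f₂) ^ 2 * p f₂ * (prob p A' + p f₁ - prob p A' * p f₁)
        * (prob p (X₁₂ ∩ A'ᶜ) - (1 - prob p A') * prob p X₀) := by
  intro e L U γ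
  -- the forced events
  have hs1 := update2_fst hf
  -- closed forms of the seven probabilities
  set g := prob p A' with hg
  set a := prob p (X₁₂ ∩ A') with ha
  set z := prob p (X₁₂ ∩ A'ᶜ) with hz
  set b := prob p (X₁ ∩ A'ᶜ) with hb
  set d := prob p (X₂ ∩ A'ᶜ) with hd
  have hX12 : prob p X₁₂ = a + z := (prob_inter_add_prob_inter_compl p X₁₂ A').symm
  have hX1 : prob p X₁ = a + b := by
    rw [← prob_inter_add_prob_inter_compl p X₁ A', h1]
  have hX2 : prob p X₂ = a + d := by
    rw [← prob_inter_add_prob_inter_compl p X₂ A', h2]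
  have hAc : prob p A'ᶜ = 1 - g := prob_compl p A'
  have PeL : prob p (e ∩ L) = p f₁ * p f₂ + p f₁ * (1 - p f₂) * g + (1 - p f₁) * p f₂ * g := by
    rw [prob_two_pin p hf]
    have e11 : {ω | Function.update (Function.update ω f₁ true) f₂ true ∈ (e ∩ L)} = Set.univ := by
      ext ω; simp [e, L, hs1, hA']
    have e10 : {ω | Function.update (Function.update ω f₁ true) f₂ false ∈ (e ∩ L)} = A' := by
      ext ω; simp [e, L, hs1, hA']
    have e01 : {ω | Function.update (Function.update ω f₁ false) f₂ true ∈ (e ∩ L)} = A' := by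
      ext ω; simp [e, L, hs1, hA']
    have e00 : {ω | Function.update (Function.update ω f₁ false) f₂ false ∈ (e ∩ L)} = ∅ := by
      ext ω; simp [e, L, hs1, hA']
    rw [e11, e10, e01, e00, prob_univ, prob_empty]; ring
  have PUeL : prob p (U ∩ (e ∩ L)) = p f₁ * p f₂ * (a + z) + p f₁ * (1 - p f₂) * a
      + (1 - p f₁) * p f₂ * a := by
    rw [prob_two_pin p hf]
    have e11 : {ω | Function.update (Function.update ω f₁ true) f₂ true ∈ (U ∩ (e ∩ L))} = X₁₂ := by
      ext ω; simp [e, L, U, hs1, hA', hX₁₂]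
    have e10 : {ω | Function.update (Function.update ω f₁ true) f₂ false ∈ (U ∩ (e ∩ L))} = X₁ ∩ A' := by
      ext ω; simp [e, L, U, hs1, hA', hX₁]
    have e01 : {ω | Function.update (Function.update ω f₁ false) f₂ true ∈ (U ∩ (e ∩ L))} = X₂ ∩ A' := by
      ext ω; simp [e, L, U, hs1, hA', hX₂]
    have e00 : {ω | Function.update (Function.update ω f₁ false) f₂ false ∈ (U ∩ (e ∩ L))} = ∅ := by
      ext ω; simp [e, L, U, hs1]
    rw [e11, e10, e01, e00, prob_empty, hX12, h1, h2]; ring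
  have PenL : prob p (e ∩ Lᶜ) = p f₁ * (1 - p f₂) * (1 - g) := by
    rw [prob_two_pin p hf]
    have e11 : {ω | Function.update (Function.update ω f₁ true) f₂ true ∈ (e ∩ Lᶜ)} = ∅ := by
      ext ω; simp [e, L, hs1]
    have e10 : {ω | Function.update (Function.update ω f₁ true) f₂ false ∈ (e ∩ Lᶜ)} = A'ᶜ := by
      ext ω; simp [e, L, hs1, hA']
    have e01 : {ω | Function.update (Function.update ω f₁ false) f₂ true ∈ (e ∩ Lᶜ)} = ∅ := by
      ext ω; simp [e, L, hs1]
    have e00 : {ω | Function.update (Function.update ω f₁ false) f₂ false ∈ (e ∩ Lᶜ)} = ∅ := by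
      ext ω; simp [e, L, hs1]
    rw [e11, e10, e01, e00, prob_empty, hAc]; ring
  have PUenL : prob p (U ∩ (e ∩ Lᶜ)) = p f₁ * (1 - p f₂) * b := by
    rw [prob_two_pin p hf]
    have e11 : {ω | Function.update (Function.update ω f₁ true) f₂ true ∈ (U ∩ (e ∩ Lᶜ))} = ∅ := by
      ext ω; simp [e, L, U, hs1]
    have e10 : {ω | Function.update (Function.update ω f₁ true) f₂ false ∈ (U ∩ (e ∩ Lᶜ))} = X₁ ∩ A'ᶜ := by
      ext ω; simp [e, L, U, hs1, hA', hX₁]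
    have e01 : {ω | Function.update (Function.update ω f₁ false) f₂ true ∈ (U ∩ (e ∩ Lᶜ))} = ∅ := by
      ext ω; simp [e, L, U, hs1]
    have e00 : {ω | Function.update (Function.update ω f₁ false) f₂ false ∈ (U ∩ (e ∩ Lᶜ))} = ∅ := by
      ext ω; simp [e, L, U, hs1]
    rw [e11, e10, e01, e00, prob_empty]; ring
  set x₀ := prob p X₀ with hx₀
  have PU : prob p U = p f₁ * p f₂ * (a + z) + p f₁ * (1 - p f₂) * (a + b)
      + (1 - p f₁) * p f₂ * (a + d) + (1 - p f₁) * (1 - p f₂) * x₀ := by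
    rw [prob_two_pin p hf]
    have e11 : {ω | Function.update (Function.update ω f₁ true) f₂ true ∈ U} = X₁₂ := by
      ext ω; simp [U, hs1, hX₁₂, hX₀]
    have e10 : {ω | Function.update (Function.update ω f₁ true) f₂ false ∈ U} = X₁ := by
      ext ω; simp [U, hs1, hX₁, hX₀]
    have e01 : {ω | Function.update (Function.update ω f₁ false) f₂ true ∈ U} = X₂ := by
      ext ω; simp [U, hs1, hX₂, hX₀]
    have e00 : {ω | Function.update (Function.update ω f₁ false) f₂ false ∈ U} = X₀ := by
      ext ω; simp [U, hs1, hX₀]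
    rw [e11, e10, e01, e00, hX12, hX1, hX2]
  have PB : prob p (eᶜ ∩ Lᶜ ∩ γ) = (1 - p f₁) * (1 - p f₂) * g := by
    rw [prob_two_pin p hf]
    have e11 : {ω | Function.update (Function.update ω f₁ true) f₂ true ∈ (eᶜ ∩ Lᶜ ∩ γ)} = ∅ := by
      ext ω; simp [e, L, γ, hs1]
    have e10 : {ω | Function.update (Function.update ω f₁ true) f₂ false ∈ (eᶜ ∩ Lᶜ ∩ γ)} = ∅ := by
      ext ω; simp [e, L, γ, hs1]
    have e01 : {ω | Function.update (Function.update ω f₁ false) f₂ true ∈ (eᶜ ∩ Lᶜ ∩ γ)} = ∅ := by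
      ext ω; simp [e, L, γ, hs1]
    have e00 : {ω | Function.update (Function.update ω f₁ false) f₂ false ∈ (eᶜ ∩ Lᶜ ∩ γ)} = A' := by
      ext ω; simp [e, L, γ, hs1, hA']
    rw [e11, e10, e01, e00, prob_empty]; ring
  have PD : prob p (eᶜ ∩ Lᶜ ∩ γᶜ) = (1 - p f₁) * (1 - p f₂) * (1 - g) := by
    rw [prob_two_pin p hf]
    have e11 : {ω | Function.update (Function.update ω f₁ true) f₂ true ∈ (eᶜ ∩ Lᶜ ∩ γᶜ)} = ∅ := by
      ext ω; simp [e, L, γ, hs1]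
    have e10 : {ω | Function.update (Function.update ω f₁ true) f₂ false ∈ (eᶜ ∩ Lᶜ ∩ γᶜ)} = ∅ := by
      ext ω; simp [e, L, γ, hs1]
    have e01 : {ω | Function.update (Function.update ω f₁ false) f₂ true ∈ (eᶜ ∩ Lᶜ ∩ γᶜ)} = ∅ := by
      ext ω; simp [e, L, γ, hs1]
    have e00 : {ω | Function.update (Function.update ω f₁ false) f₂ false ∈ (eᶜ ∩ Lᶜ ∩ γᶜ)} = A'ᶜ := by
      ext ω; simp [e, L, γ, hs1, hA']
    rw [e11, e10, e01, e00, prob_empty, hAc]; ring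
  -- the probabilistic inputs
  have hHar : (a + z) * g ≤ a := by
    have := prob_mul_prob_le_prob_inter hp hX₁₂up hA'up
    rwa [hX12] at this
  have hzb : b ≤ z := prob_mono hp (Set.inter_subset_inter_left _ h1s)
  have hzd : d ≤ z := prob_mono hp (Set.inter_subset_inter_left _ h2s)
  have ha0 : 0 ≤ a := prob_nonneg hp _
  have hz0 : 0 ≤ z := prob_nonneg hp _
  have hb0 : 0 ≤ b := prob_nonneg hp _
  have hd0 : 0 ≤ d := prob_nonneg hp _
  have hg0 : 0 ≤ g := prob_nonneg hp _
  have hg1 : g ≤ 1 := prob_le_one hp _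
  have hp1 := hp.nonneg f₁
  have hp1' := hp.le_one f₁
  have hp2 := hp.nonneg f₂
  have hp2' := hp.le_one f₂
  -- the algebra
  rw [PeL, PUeL, PenL, PUenL, PU, PB, PD]
  exact zc_two_edge_alg' (p f₁) (p f₂) g a z b d x₀ hp1 hp1' hp2 hp2' hg0 hg1 hHar hzb hzd

/-- The extended theorem gives (ZC) itself when the remainder `X₀ ⊆ X₁₂` is independent of (or
positively correlated with) `A'ᶜ`: `P(X₀) P(A'ᶜ) ≤ P(X₀ ∩ A'ᶜ)`. -/
theorem zc_two_edge'_nonneg {p : E → R} (hp : IsProbVec p) {f₁ f₂ : E} (hf : f₁ ≠ f₂)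
    {A' X₁ X₂ X₁₂ X₀ : Set (Config E)}
    (hA' : ∀ (ω : Config E) (b₁ b₂ : Bool),
      Function.update (Function.update ω f₁ b₁) f₂ b₂ ∈ A' ↔ ω ∈ A')
    (hX₁ : ∀ (ω : Config E) (b₁ b₂ : Bool),
      Function.update (Function.update ω f₁ b₁) f₂ b₂ ∈ X₁ ↔ ω ∈ X₁)
    (hX₂ : ∀ (ω : Config E) (b₁ b₂ : Bool),
      Function.update (Function.update ω f₁ b₁) f₂ b₂ ∈ X₂ ↔ ω ∈ X₂)
    (hX₁₂ : ∀ (ω : Config E) (b₁ b₂ : Bool),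
      Function.update (Function.update ω f₁ b₁) f₂ b₂ ∈ X₁₂ ↔ ω ∈ X₁₂)
    (hX₀ : ∀ (ω : Config E) (b₁ b₂ : Bool),
      Function.update (Function.update ω f₁ b₁) f₂ b₂ ∈ X₀ ↔ ω ∈ X₀)
    (hA'up : IsUpperSet A') (hX₁₂up : IsUpperSet X₁₂)
    (h1 : X₁ ∩ A' = X₁₂ ∩ A') (h2 : X₂ ∩ A' = X₁₂ ∩ A') (h1s : X₁ ⊆ X₁₂) (h2s : X₂ ⊆ X₁₂)
    (h0s : X₀ ⊆ X₁₂) (hind : prob p X₀ * prob p A'ᶜ ≤ prob p (X₀ ∩ A'ᶜ)) :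
    let e := openEdge f₁ ∪ (openEdge f₂ ∩ A')
    let L := openEdge f₂ ∪ (openEdge f₁ ∩ A')
    let U := (openEdge f₁ ∩ closedEdge f₂ ∩ X₁) ∪ (closedEdge f₁ ∩ openEdge f₂ ∩ X₂)
      ∪ (openEdge f₁ ∩ openEdge f₂ ∩ X₁₂) ∪ (closedEdge f₁ ∩ closedEdge f₂ ∩ X₀)
    let γ := A' ∪ (openEdge f₁ ∩ openEdge f₂)
    0 ≤ prob p (eᶜ ∩ Lᶜ ∩ γᶜ) * (prob p (U ∩ (e ∩ L)) - prob p U * prob p (e ∩ L))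
      - prob p (eᶜ ∩ Lᶜ ∩ γ) * (prob p (U ∩ (e ∩ Lᶜ)) - prob p U * prob p (e ∩ Lᶜ)) := by
  intro e L U γ
  have hmain := zc_two_edge' hp hf hA' hX₁ hX₂ hX₁₂ hX₀ hA'up hX₁₂up h1 h2 h1s h2s
  have hz : (1 - prob p A') * prob p X₀ ≤ prob p (X₁₂ ∩ A'ᶜ) := by
    rw [← prob_compl p A', mul_comm]
    exact hind.trans (prob_mono hp (Set.inter_subset_inter_left _ h0s))
  have hπ0 : 0 ≤ prob p A' + p f₁ - prob p A' * p f₁ := by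
    have := mul_nonneg (prob_nonneg hp A') (sub_nonneg.2 (hp.le_one f₁))
    have := hp.nonneg f₁
    linarith
  have hb : 0 ≤ (1 - p f₁) ^ 2 * (1 - p f₂) ^ 2 * p f₂ * (prob p A' + p f₁ - prob p A' * p f₁)
      * (prob p (X₁₂ ∩ A'ᶜ) - (1 - prob p A') * prob p X₀) :=
    mul_nonneg (mul_nonneg (mul_nonneg (mul_nonneg (sq_nonneg _) (sq_nonneg _)) (hp.nonneg f₂))
      hπ0) (sub_nonneg.2 hz)
  exact hb.trans hmain

end TwoEdgeTheorem

end Summit.Ventures.PercRepro2
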